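import Summits.Ventures.HSemireg.LeadingDigitRemainder
import Summits.Ventures.HSemireg.CliqueRemainderReadings
import Summits.Ventures.HSemireg.TwoVectorDividedPowers
import Summits.Ventures.HSemireg.CliqueClosedForms

/-!
# The seven clique units are CLASS-DEAD — one theorem each (pub-hsemireg, S4-PUSH corner 2)

Kernel leg of seat s4-search-2 gen 16 (cell `pub-hsemireg`); companion of `EdgeUnitClassDead.lean` ∕ `MixedFrameClassDead.lean`
for the clique units of «S2-21» §5 LEMMAS D(b) ∕ E (memo `s4push/search-2/g11/LIFT2-search-2-g11.md`): types (2,2,2,2,3,5)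
(`TwoAdicReadings.lemmaD_b_reading_Km2235_completion`, ROW A) and (2,2,2,2,4,4), (2,2,2,3,3,4), (1,1,1,1,2,2), (1,1,1,1,1,3),
(1,1,1,1,1,2), (1,1,1,1,1,1) (`CliqueRemainderReadings.reading_<type>`, ROW C; frames in ROW B).  Those readings prove
`T₃(P₁ + 2Z) ≠ 2^{v+1}·Z′` for every remainder `Z` GIVEN the registered closed forms `E₂ = P₂ + 2P₁Z + 4Z₂`,
`E₃ = P₃ + 2P₂Z + 4P₁Z₂ + 8Z₃` of the divided powers of `P₁ + 2Z` (`Z₂, Z₃` free).  Here, as in ROW J for the edge unit, the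
closed-form GIVEN is removed: `CliqueClosedForms.closedForms_clique3 ∕ 4 ∕ 5 ∕ 6` (FILE L1: the clique sums satisfy `P₁·P₁ = 2P₂`,
`P₁·P₁·P₁ = 6P₃` in the commutative `Λ`, then the divided-power binomial law), the
divided powers of the integral 2-form `Z` exist in `Λ` (`TwoVectorDividedPowers.exists_dividedPowers_of_mem_span`, ROW H), and
`EdgeUnitClassDead.cancel_two ∕ cancel_six` (torsion-freeness); so `classDead_<type>`: for ANY integral 2-form `Z` and the class
2-form `B = P₁ + 2Z` with ANY `B₂, B₃` such that `B·B = 2B₂`, `B·B·B = 6B₃`, the registered `T₃(B)` of the type is not in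
`2^{v+1}Λ` (`256` for the three `q = 4` types — CRITERION L's modulus is `2¹⁰`; `32` for the four `q = 2` types — modulus `2⁵`):
CRITERION L fails at `k = 3` for every completion of the clique leading digit.

Scope ∕ honest framing as in ROW J: CLASS-LEVEL statements for single units of a NECESSARY-condition sieve (CRITERION L) at the
special fibre `E⁶`; that the clique sum `P₁` IS the unit's leading digit, that CRITERION L is the registered necessary condition,
the signature table and the unit lists ∕ census are framework words; theorems only (count-neutral, no `def`); no object, no `σ`
computation, no Hodge statement; nothing here bears on HC ∕ HC_CM ∕ HC_AV.
-/

namespace Summit.Ventures.HSemireg.CliqueUnitsClassDead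

open ExteriorAlgebra TwoAdicReadings CliqueRemainderReadings TwoVectorDividedPowers CliqueClosedForms

section LocalTools

/-! ### 0. Local tools (restated from ROW J so that this file imports only the rows it uses) -/

variable {M : Type*} [AddCommGroup M] [Module ℤ M]

/-- Cancelling `2` (torsion-freeness, `LeadingDigitRemainder.natCast_mul_cancel`); a `private` local helper — the same
statement is landed as `MixedFrameClassDead.cancel_two` (gate `dedup.landed`). -/
private theorem cancel_two (x : Module.Basis (Fin 12) ℤ M) {Q Q' : ExteriorAlgebra ℤ M}
    (h : (2 : ExteriorAlgebra ℤ M) * Q = 2 * Q') : Q = Q' :=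
  LeadingDigitRemainder.natCast_mul_cancel x 2 (by norm_num) Q Q' (by exact_mod_cast h)

/-- Cancelling `6`; a `private` local helper (ROW J's `EdgeUnitClassDead.cancel_six` may land first). -/
private theorem cancel_six (x : Module.Basis (Fin 12) ℤ M) {Q Q' : ExteriorAlgebra ℤ M}
    (h : (6 : ExteriorAlgebra ℤ M) * Q = 6 * Q') : Q = Q' :=
  LeadingDigitRemainder.natCast_mul_cancel x 6 (by norm_num) Q Q' (by exact_mod_cast h)

end LocalTools

variable {M : Type*} [AddCommGroup M] [Module ℤ M]

/-- **Clique unit of type (2,2,2,2,3,5) (clique = slots `0 … 3`): CLASS-DEAD as one theorem.**  `M` free with basis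
`x : Fin 12`; the clique leading digit `P₁` with its closed forms `P₂, P₃`; the type `D` with the registered `D₂, D₃` and the
σ-parametrisation of the reading `lemmaD_b_reading_Km2235_completion` (`q = 4`, modulus `2¹⁰`); ANY `Z` in the span of the 2-vectors (every integral 2-form) and the
class 2-form `B = P₁ + 2Z` with ANY `B₂, B₃` such that `B·B = 2B₂`, `B·B·B = 6B₃`; the registered `T₃(B)`.  THEN
`T₃(B) ≠ 256·Z′` for every `Z′`: the reading with NO closed-form GIVEN (`closedForms_clique4` + ROW H + cancellation). -/
theorem classDead_Km2235 (x : Module.Basis (Fin 12) ℤ M) (Λ : Subalgebra ℤ (ExteriorAlgebra ℤ M))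
    (h₀ h₁ h₂ h₃ h₄ h₅ σ₀ σ₁ σ₂ σ₃ s t u P₁ P₂ P₃ D D₂ D₃ Z B B₂ B₃ T₃ : ExteriorAlgebra ℤ M)
    (hΛ : Λ = Algebra.adjoin ℤ (Set.range fun p : M × M => ι ℤ p.1 * ι ℤ p.2))
    (hh₀ : h₀ = ι ℤ (x 0) * ι ℤ (x 1)) (hh₁ : h₁ = ι ℤ (x 2) * ι ℤ (x 3)) (hh₂ : h₂ = ι ℤ (x 4) * ι ℤ (x 5))
    (hh₃ : h₃ = ι ℤ (x 6) * ι ℤ (x 7)) (hh₄ : h₄ = ι ℤ (x 8) * ι ℤ (x 9)) (hh₅ : h₅ = ι ℤ (x 10) * ι ℤ (x 11))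
    (ms : s ∈ Λ) (mt : t ∈ Λ) (mu : u ∈ Λ)
    (hP₁ : P₁ = h₀ + h₁ + h₂ + h₃)
    (hP₂ : P₂ = h₀ * h₁ + h₀ * h₂ + h₀ * h₃ + h₁ * h₂ + h₁ * h₃ + h₂ * h₃)
    (hP₃ : P₃ = h₀ * h₁ * h₂ + h₀ * h₁ * h₃ + h₀ * h₂ * h₃ + h₁ * h₂ * h₃)
    (hD : D = 4 * P₁ + 8 * h₄ + 32 * h₅)
    (hD₂ : D₂ = (256) * h₄ * h₅ + (128) * P₁ * h₅ + (32) * P₁ * h₄ + (16) * P₂)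
    (hD₃ : D₃ = (1024) * P₁ * h₄ * h₅ + (512) * P₂ * h₅ + (128) * P₂ * h₄ + (64) * P₃)
    (mZspan : Z ∈ Submodule.span ℤ (Set.range fun p : M × M => ι ℤ p.1 * ι ℤ p.2))
    (hB : B = P₁ + 2 * Z) (qB : B * B = 2 * B₂) (cB : B * B * B = 6 * B₃)
    (hσ₁ : σ₁ = 0) (hσ₂ : σ₂ = 4 * t - σ₀) (hσ₀ : σ₀ = 2 * s + 1) (hσ₃ : σ₃ = 4 * u)
    (hT₃ : T₃ = σ₃ * D₃ - 4 * σ₂ * (D₂ * B) + 16 * σ₁ * (D * B₂) - 64 * σ₀ * B₃) :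
    ∀ Z' : ExteriorAlgebra ℤ M, T₃ ≠ 256 * Z' := by
  intro Z' hZ'
  have span_le : Submodule.span ℤ (Set.range fun p : M × M => ι ℤ p.1 * ι ℤ p.2) ≤ Subalgebra.toSubmodule Λ := by
    rw [hΛ]; exact Algebra.span_le_adjoin ℤ _
  have mZ : Z ∈ Λ := span_le mZspan
  obtain ⟨Z₂, mZ₂', Z₃, mZ₃', qZ, cZ⟩ := exists_dividedPowers_of_mem_span Z mZspan
  have mZ₂ : Z₂ ∈ Λ := hΛ ▸ mZ₂'
  have mZ₃ : Z₃ ∈ Λ := hΛ ▸ mZ₃'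
  obtain ⟨k₂, k₃⟩ := closedForms_clique4 x Λ h₀ h₁ h₂ h₃ P₁ P₂ P₃ Z Z₂ Z₃ B hΛ hh₀ hh₁ hh₂ hh₃ mZ mZ₂ mZ₃ hP₁ hP₂ hP₃ qZ cZ hB
  have hB₂c := cancel_two x (qB.symm.trans k₂)
  have hB₃c := cancel_six x (cB.symm.trans k₃)
  exact lemmaD_b_reading_Km2235_completion x Λ h₀ h₁ h₂ h₃ h₄ h₅ σ₀ σ₁ σ₂ σ₃ s t u P₁ P₂ P₃ D D₂ D₃ Z Z₂ Z₃ B₂ B₃ T₃ hΛ hh₀ hh₁ hh₂ hh₃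
    hh₄ hh₅ ms mt mu mZ mZ₂ mZ₃ hP₁ hP₂ hP₃ hD hD₂ hD₃ hB₂c hB₃c (by rw [hT₃, hB]) hσ₁ hσ₂ hσ₀ hσ₃ Z' hZ'

/-- **Clique unit of type (2,2,2,2,4,4) (clique = slots `0 … 3`): CLASS-DEAD as one theorem.**  `M` free with basis
`x : Fin 12`; the clique leading digit `P₁` with its closed forms `P₂, P₃`; the type `D` with the registered `D₂, D₃` and the
σ-parametrisation of the reading `reading_Km2244` (`q = 4`, modulus `2¹⁰`); ANY `Z` in the span of the 2-vectors (every integral 2-form) and the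
class 2-form `B = P₁ + 2Z` with ANY `B₂, B₃` such that `B·B = 2B₂`, `B·B·B = 6B₃`; the registered `T₃(B)`.  THEN
`T₃(B) ≠ 256·Z′` for every `Z′`: the reading with NO closed-form GIVEN (`closedForms_clique4` + ROW H + cancellation). -/
theorem classDead_Km2244 (x : Module.Basis (Fin 12) ℤ M) (Λ : Subalgebra ℤ (ExteriorAlgebra ℤ M))
    (h₀ h₁ h₂ h₃ h₄ h₅ σ₀ σ₁ σ₂ σ₃ s t u P₁ P₂ P₃ D D₂ D₃ Z B B₂ B₃ T₃ : ExteriorAlgebra ℤ M)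
    (hΛ : Λ = Algebra.adjoin ℤ (Set.range fun p : M × M => ι ℤ p.1 * ι ℤ p.2))
    (hh₀ : h₀ = ι ℤ (x 0) * ι ℤ (x 1)) (hh₁ : h₁ = ι ℤ (x 2) * ι ℤ (x 3)) (hh₂ : h₂ = ι ℤ (x 4) * ι ℤ (x 5))
    (hh₃ : h₃ = ι ℤ (x 6) * ι ℤ (x 7)) (hh₄ : h₄ = ι ℤ (x 8) * ι ℤ (x 9)) (hh₅ : h₅ = ι ℤ (x 10) * ι ℤ (x 11))
    (ms : s ∈ Λ) (mt : t ∈ Λ) (mu : u ∈ Λ)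
    (hP₁ : P₁ = h₀ + h₁ + h₂ + h₃)
    (hP₂ : P₂ = h₀ * h₁ + h₀ * h₂ + h₀ * h₃ + h₁ * h₂ + h₁ * h₃ + h₂ * h₃)
    (hP₃ : P₃ = h₀ * h₁ * h₂ + h₀ * h₁ * h₃ + h₀ * h₂ * h₃ + h₁ * h₂ * h₃)
    (hD : D = 4 * P₁ + 16 * h₄ + 16 * h₅)
    (hD₂ : D₂ = (256) * h₄ * h₅ + (64) * P₁ * h₅ + (64) * P₁ * h₄ + (16) * P₂)
    (hD₃ : D₃ = (1024) * P₁ * h₄ * h₅ + (256) * P₂ * h₅ + (256) * P₂ * h₄ + (64) * P₃)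
    (mZspan : Z ∈ Submodule.span ℤ (Set.range fun p : M × M => ι ℤ p.1 * ι ℤ p.2))
    (hB : B = P₁ + 2 * Z) (qB : B * B = 2 * B₂) (cB : B * B * B = 6 * B₃)
    (hσ₁ : σ₁ = 0) (hσ₂ : σ₂ = 4 * t - σ₀) (hσ₀ : σ₀ = 2 * s + 1) (hσ₃ : σ₃ = 4 * u)
    (hT₃ : T₃ = σ₃ * D₃ - 4 * σ₂ * (D₂ * B) + 16 * σ₁ * (D * B₂) - 64 * σ₀ * B₃) :
    ∀ Z' : ExteriorAlgebra ℤ M, T₃ ≠ 256 * Z' := by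
  intro Z' hZ'
  have span_le : Submodule.span ℤ (Set.range fun p : M × M => ι ℤ p.1 * ι ℤ p.2) ≤ Subalgebra.toSubmodule Λ := by
    rw [hΛ]; exact Algebra.span_le_adjoin ℤ _
  have mZ : Z ∈ Λ := span_le mZspan
  obtain ⟨Z₂, mZ₂', Z₃, mZ₃', qZ, cZ⟩ := exists_dividedPowers_of_mem_span Z mZspan
  have mZ₂ : Z₂ ∈ Λ := hΛ ▸ mZ₂'
  have mZ₃ : Z₃ ∈ Λ := hΛ ▸ mZ₃'
  obtain ⟨k₂, k₃⟩ := closedForms_clique4 x Λ h₀ h₁ h₂ h₃ P₁ P₂ P₃ Z Z₂ Z₃ B hΛ hh₀ hh₁ hh₂ hh₃ mZ mZ₂ mZ₃ hP₁ hP₂ hP₃ qZ cZ hB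
  have hB₂c := cancel_two x (qB.symm.trans k₂)
  have hB₃c := cancel_six x (cB.symm.trans k₃)
  exact reading_Km2244 x Λ h₀ h₁ h₂ h₃ h₄ h₅ σ₀ σ₁ σ₂ σ₃ s t u P₁ P₂ P₃ D D₂ D₃ Z Z₂ Z₃ B₂ B₃ T₃ hΛ hh₀ hh₁ hh₂ hh₃
    hh₄ hh₅ ms mt mu mZ mZ₂ mZ₃ hP₁ hP₂ hP₃ hD hD₂ hD₃ hB₂c hB₃c (by rw [hT₃, hB]) hσ₁ hσ₂ hσ₀ hσ₃ Z' hZ'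

/-- **Clique unit of type (2,2,2,3,3,4) (clique = slots `0 … 2`): CLASS-DEAD as one theorem.**  `M` free with basis
`x : Fin 12`; the clique leading digit `P₁` with its closed forms `P₂, P₃`; the type `D` with the registered `D₂, D₃` and the
σ-parametrisation of the reading `reading_Km2334` (`q = 4`, modulus `2¹⁰`); ANY `Z` in the span of the 2-vectors (every integral 2-form) and the
class 2-form `B = P₁ + 2Z` with ANY `B₂, B₃` such that `B·B = 2B₂`, `B·B·B = 6B₃`; the registered `T₃(B)`.  THEN
`T₃(B) ≠ 256·Z′` for every `Z′`: the reading with NO closed-form GIVEN (`closedForms_clique3` + ROW H + cancellation). -/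
theorem classDead_Km2334 (x : Module.Basis (Fin 12) ℤ M) (Λ : Subalgebra ℤ (ExteriorAlgebra ℤ M))
    (h₀ h₁ h₂ h₃ h₄ h₅ σ₀ σ₁ σ₂ σ₃ s t u P₁ P₂ P₃ D D₂ D₃ Z B B₂ B₃ T₃ : ExteriorAlgebra ℤ M)
    (hΛ : Λ = Algebra.adjoin ℤ (Set.range fun p : M × M => ι ℤ p.1 * ι ℤ p.2))
    (hh₀ : h₀ = ι ℤ (x 0) * ι ℤ (x 1)) (hh₁ : h₁ = ι ℤ (x 2) * ι ℤ (x 3)) (hh₂ : h₂ = ι ℤ (x 4) * ι ℤ (x 5))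
    (hh₃ : h₃ = ι ℤ (x 6) * ι ℤ (x 7)) (hh₄ : h₄ = ι ℤ (x 8) * ι ℤ (x 9)) (hh₅ : h₅ = ι ℤ (x 10) * ι ℤ (x 11))
    (ms : s ∈ Λ) (mt : t ∈ Λ) (mu : u ∈ Λ)
    (hP₁ : P₁ = h₀ + h₁ + h₂)
    (hP₂ : P₂ = h₀ * h₁ + h₀ * h₂ + h₁ * h₂)
    (hP₃ : P₃ = h₀ * h₁ * h₂)
    (hD : D = 4 * P₁ + 8 * h₃ + 8 * h₄ + 16 * h₅)
    (hD₂ : D₂ = (128) * h₄ * h₅ + (128) * h₃ * h₅ + (64) * h₃ * h₄ + (64) * P₁ * h₅ + (32) * P₁ * h₄ + (32) * P₁ *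
      h₃ + (16) * P₂)
    (hD₃ : D₃ = (1024) * h₃ * h₄ * h₅ + (512) * P₁ * h₄ * h₅ + (512) * P₁ * h₃ * h₅ + (256) * P₁ * h₃ * h₄ + (256)
      * P₂ * h₅ + (128) * P₂ * h₄ + (128) * P₂ * h₃ + (64) * P₃)
    (mZspan : Z ∈ Submodule.span ℤ (Set.range fun p : M × M => ι ℤ p.1 * ι ℤ p.2))
    (hB : B = P₁ + 2 * Z) (qB : B * B = 2 * B₂) (cB : B * B * B = 6 * B₃)
    (hσ₁ : σ₁ = 0) (hσ₂ : σ₂ = 4 * t - σ₀) (hσ₀ : σ₀ = 2 * s + 1) (hσ₃ : σ₃ = 4 * u)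
    (hT₃ : T₃ = σ₃ * D₃ - 4 * σ₂ * (D₂ * B) + 16 * σ₁ * (D * B₂) - 64 * σ₀ * B₃) :
    ∀ Z' : ExteriorAlgebra ℤ M, T₃ ≠ 256 * Z' := by
  intro Z' hZ'
  have span_le : Submodule.span ℤ (Set.range fun p : M × M => ι ℤ p.1 * ι ℤ p.2) ≤ Subalgebra.toSubmodule Λ := by
    rw [hΛ]; exact Algebra.span_le_adjoin ℤ _
  have mZ : Z ∈ Λ := span_le mZspan
  obtain ⟨Z₂, mZ₂', Z₃, mZ₃', qZ, cZ⟩ := exists_dividedPowers_of_mem_span Z mZspan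
  have mZ₂ : Z₂ ∈ Λ := hΛ ▸ mZ₂'
  have mZ₃ : Z₃ ∈ Λ := hΛ ▸ mZ₃'
  obtain ⟨k₂, k₃⟩ := closedForms_clique3 x Λ h₀ h₁ h₂ P₁ P₂ P₃ Z Z₂ Z₃ B hΛ hh₀ hh₁ hh₂ mZ mZ₂ mZ₃ hP₁ hP₂ hP₃ qZ cZ hB
  have hB₂c := cancel_two x (qB.symm.trans k₂)
  have hB₃c := cancel_six x (cB.symm.trans k₃)
  exact reading_Km2334 x Λ h₀ h₁ h₂ h₃ h₄ h₅ σ₀ σ₁ σ₂ σ₃ s t u P₁ P₂ P₃ D D₂ D₃ Z Z₂ Z₃ B₂ B₃ T₃ hΛ hh₀ hh₁ hh₂ hh₃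
    hh₄ hh₅ ms mt mu mZ mZ₂ mZ₃ hP₁ hP₂ hP₃ hD hD₂ hD₃ hB₂c hB₃c (by rw [hT₃, hB]) hσ₁ hσ₂ hσ₀ hσ₃ Z' hZ'

/-- **Clique unit of type (1,1,1,1,2,2) (clique = slots `0 … 3`): CLASS-DEAD as one theorem.**  `M` free with basis
`x : Fin 12`; the clique leading digit `P₁` with its closed forms `P₂, P₃`; the type `D` with the registered `D₂, D₃` and the
σ-parametrisation of the reading `reading_Km1122` (`q = 2`, modulus `2⁵`); ANY `Z` in the span of the 2-vectors (every integral 2-form) and the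
class 2-form `B = P₁ + 2Z` with ANY `B₂, B₃` such that `B·B = 2B₂`, `B·B·B = 6B₃`; the registered `T₃(B)`.  THEN
`T₃(B) ≠ 32·Z′` for every `Z′`: the reading with NO closed-form GIVEN (`closedForms_clique4` + ROW H + cancellation). -/
theorem classDead_Km1122 (x : Module.Basis (Fin 12) ℤ M) (Λ : Subalgebra ℤ (ExteriorAlgebra ℤ M))
    (h₀ h₁ h₂ h₃ h₄ h₅ σ₀ σ₁ σ₂ σ₃ s t u P₁ P₂ P₃ D D₂ D₃ Z B B₂ B₃ T₃ : ExteriorAlgebra ℤ M)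
    (hΛ : Λ = Algebra.adjoin ℤ (Set.range fun p : M × M => ι ℤ p.1 * ι ℤ p.2))
    (hh₀ : h₀ = ι ℤ (x 0) * ι ℤ (x 1)) (hh₁ : h₁ = ι ℤ (x 2) * ι ℤ (x 3)) (hh₂ : h₂ = ι ℤ (x 4) * ι ℤ (x 5))
    (hh₃ : h₃ = ι ℤ (x 6) * ι ℤ (x 7)) (hh₄ : h₄ = ι ℤ (x 8) * ι ℤ (x 9)) (hh₅ : h₅ = ι ℤ (x 10) * ι ℤ (x 11))
    (ms : s ∈ Λ) (mt : t ∈ Λ) (mu : u ∈ Λ)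
    (hP₁ : P₁ = h₀ + h₁ + h₂ + h₃)
    (hP₂ : P₂ = h₀ * h₁ + h₀ * h₂ + h₀ * h₃ + h₁ * h₂ + h₁ * h₃ + h₂ * h₃)
    (hP₃ : P₃ = h₀ * h₁ * h₂ + h₀ * h₁ * h₃ + h₀ * h₂ * h₃ + h₁ * h₂ * h₃)
    (hD : D = 2 * P₁ + 4 * h₄ + 4 * h₅)
    (hD₂ : D₂ = (16) * h₄ * h₅ + (8) * P₁ * h₅ + (8) * P₁ * h₄ + (4) * P₂)
    (hD₃ : D₃ = (32) * P₁ * h₄ * h₅ + (16) * P₂ * h₅ + (16) * P₂ * h₄ + (8) * P₃)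
    (mZspan : Z ∈ Submodule.span ℤ (Set.range fun p : M × M => ι ℤ p.1 * ι ℤ p.2))
    (hB : B = P₁ + 2 * Z) (qB : B * B = 2 * B₂) (cB : B * B * B = 6 * B₃)
    (hσ₁ : σ₁ = 0) (hσ₂ : σ₂ = 4 * t - σ₀) (hσ₀ : σ₀ = 2 * s + 1) (hσ₃ : σ₃ = 4 * u)
    (hT₃ : T₃ = σ₃ * D₃ - 2 * σ₂ * (D₂ * B) + 4 * σ₁ * (D * B₂) - 8 * σ₀ * B₃) :
    ∀ Z' : ExteriorAlgebra ℤ M, T₃ ≠ 32 * Z' := by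
  intro Z' hZ'
  have span_le : Submodule.span ℤ (Set.range fun p : M × M => ι ℤ p.1 * ι ℤ p.2) ≤ Subalgebra.toSubmodule Λ := by
    rw [hΛ]; exact Algebra.span_le_adjoin ℤ _
  have mZ : Z ∈ Λ := span_le mZspan
  obtain ⟨Z₂, mZ₂', Z₃, mZ₃', qZ, cZ⟩ := exists_dividedPowers_of_mem_span Z mZspan
  have mZ₂ : Z₂ ∈ Λ := hΛ ▸ mZ₂'
  have mZ₃ : Z₃ ∈ Λ := hΛ ▸ mZ₃'
  obtain ⟨k₂, k₃⟩ := closedForms_clique4 x Λ h₀ h₁ h₂ h₃ P₁ P₂ P₃ Z Z₂ Z₃ B hΛ hh₀ hh₁ hh₂ hh₃ mZ mZ₂ mZ₃ hP₁ hP₂ hP₃ qZ cZ hB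
  have hB₂c := cancel_two x (qB.symm.trans k₂)
  have hB₃c := cancel_six x (cB.symm.trans k₃)
  exact reading_Km1122 x Λ h₀ h₁ h₂ h₃ h₄ h₅ σ₀ σ₁ σ₂ σ₃ s t u P₁ P₂ P₃ D D₂ D₃ Z Z₂ Z₃ B₂ B₃ T₃ hΛ hh₀ hh₁ hh₂ hh₃
    hh₄ hh₅ ms mt mu mZ mZ₂ mZ₃ hP₁ hP₂ hP₃ hD hD₂ hD₃ hB₂c hB₃c (by rw [hT₃, hB]) hσ₁ hσ₂ hσ₀ hσ₃ Z' hZ'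

/-- **Clique unit of type (1,1,1,1,1,3) (clique = slots `0 … 4`): CLASS-DEAD as one theorem.**  `M` free with basis
`x : Fin 12`; the clique leading digit `P₁` with its closed forms `P₂, P₃`; the type `D` with the registered `D₂, D₃` and the
σ-parametrisation of the reading `reading_Km11113` (`q = 2`, modulus `2⁵`); ANY `Z` in the span of the 2-vectors (every integral 2-form) and the
class 2-form `B = P₁ + 2Z` with ANY `B₂, B₃` such that `B·B = 2B₂`, `B·B·B = 6B₃`; the registered `T₃(B)`.  THEN
`T₃(B) ≠ 32·Z′` for every `Z′`: the reading with NO closed-form GIVEN (`closedForms_clique5` + ROW H + cancellation). -/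
theorem classDead_Km11113 (x : Module.Basis (Fin 12) ℤ M) (Λ : Subalgebra ℤ (ExteriorAlgebra ℤ M))
    (h₀ h₁ h₂ h₃ h₄ h₅ σ₀ σ₁ σ₂ σ₃ s t u P₁ P₂ P₃ D D₂ D₃ Z B B₂ B₃ T₃ : ExteriorAlgebra ℤ M)
    (hΛ : Λ = Algebra.adjoin ℤ (Set.range fun p : M × M => ι ℤ p.1 * ι ℤ p.2))
    (hh₀ : h₀ = ι ℤ (x 0) * ι ℤ (x 1)) (hh₁ : h₁ = ι ℤ (x 2) * ι ℤ (x 3)) (hh₂ : h₂ = ι ℤ (x 4) * ι ℤ (x 5))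
    (hh₃ : h₃ = ι ℤ (x 6) * ι ℤ (x 7)) (hh₄ : h₄ = ι ℤ (x 8) * ι ℤ (x 9)) (hh₅ : h₅ = ι ℤ (x 10) * ι ℤ (x 11))
    (ms : s ∈ Λ) (mt : t ∈ Λ) (mu : u ∈ Λ)
    (hP₁ : P₁ = h₀ + h₁ + h₂ + h₃ + h₄)
    (hP₂ : P₂ = h₀ * h₁ + h₀ * h₂ + h₀ * h₃ + h₀ * h₄ + h₁ * h₂ + h₁ * h₃ + h₁ * h₄ + h₂ * h₃ + h₂ * h₄ + h₃ * h₄)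
    (hP₃ : P₃ = h₀ * h₁ * h₂ + h₀ * h₁ * h₃ + h₀ * h₁ * h₄ + h₀ * h₂ * h₃ + h₀ * h₂ * h₄ + h₀ * h₃ * h₄ + h₁ * h₂ * h₃ +
      h₁ * h₂ * h₄ + h₁ * h₃ * h₄ + h₂ * h₃ * h₄)
    (hD : D = 2 * P₁ + 8 * h₅)
    (hD₂ : D₂ = (16) * P₁ * h₅ + (4) * P₂)
    (hD₃ : D₃ = (32) * P₂ * h₅ + (8) * P₃)
    (mZspan : Z ∈ Submodule.span ℤ (Set.range fun p : M × M => ι ℤ p.1 * ι ℤ p.2))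
    (hB : B = P₁ + 2 * Z) (qB : B * B = 2 * B₂) (cB : B * B * B = 6 * B₃)
    (hσ₁ : σ₁ = 0) (hσ₂ : σ₂ = 4 * t - σ₀) (hσ₀ : σ₀ = 2 * s + 1) (hσ₃ : σ₃ = 4 * u)
    (hT₃ : T₃ = σ₃ * D₃ - 2 * σ₂ * (D₂ * B) + 4 * σ₁ * (D * B₂) - 8 * σ₀ * B₃) :
    ∀ Z' : ExteriorAlgebra ℤ M, T₃ ≠ 32 * Z' := by
  intro Z' hZ'
  have span_le : Submodule.span ℤ (Set.range fun p : M × M => ι ℤ p.1 * ι ℤ p.2) ≤ Subalgebra.toSubmodule Λ := by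
    rw [hΛ]; exact Algebra.span_le_adjoin ℤ _
  have mZ : Z ∈ Λ := span_le mZspan
  obtain ⟨Z₂, mZ₂', Z₃, mZ₃', qZ, cZ⟩ := exists_dividedPowers_of_mem_span Z mZspan
  have mZ₂ : Z₂ ∈ Λ := hΛ ▸ mZ₂'
  have mZ₃ : Z₃ ∈ Λ := hΛ ▸ mZ₃'
  obtain ⟨k₂, k₃⟩ := closedForms_clique5 x Λ h₀ h₁ h₂ h₃ h₄ P₁ P₂ P₃ Z Z₂ Z₃ B hΛ hh₀ hh₁ hh₂ hh₃ hh₄ mZ mZ₂ mZ₃ hP₁ hP₂ hP₃ qZ cZ hB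
  have hB₂c := cancel_two x (qB.symm.trans k₂)
  have hB₃c := cancel_six x (cB.symm.trans k₃)
  exact reading_Km11113 x Λ h₀ h₁ h₂ h₃ h₄ h₅ σ₀ σ₁ σ₂ σ₃ s t u P₁ P₂ P₃ D D₂ D₃ Z Z₂ Z₃ B₂ B₃ T₃ hΛ hh₀ hh₁ hh₂ hh₃
    hh₄ hh₅ ms mt mu mZ mZ₂ mZ₃ hP₁ hP₂ hP₃ hD hD₂ hD₃ hB₂c hB₃c (by rw [hT₃, hB]) hσ₁ hσ₂ hσ₀ hσ₃ Z' hZ'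

/-- **Clique unit of type (1,1,1,1,1,2) (clique = slots `0 … 4`): CLASS-DEAD as one theorem.**  `M` free with basis
`x : Fin 12`; the clique leading digit `P₁` with its closed forms `P₂, P₃`; the type `D` with the registered `D₂, D₃` and the
σ-parametrisation of the reading `reading_Km11112` (`q = 2`, modulus `2⁵`); ANY `Z` in the span of the 2-vectors (every integral 2-form) and the
class 2-form `B = P₁ + 2Z` with ANY `B₂, B₃` such that `B·B = 2B₂`, `B·B·B = 6B₃`; the registered `T₃(B)`.  THEN
`T₃(B) ≠ 32·Z′` for every `Z′`: the reading with NO closed-form GIVEN (`closedForms_clique5` + ROW H + cancellation). -/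
theorem classDead_Km11112 (x : Module.Basis (Fin 12) ℤ M) (Λ : Subalgebra ℤ (ExteriorAlgebra ℤ M))
    (h₀ h₁ h₂ h₃ h₄ h₅ σ₀ σ₁ σ₂ σ₃ s t u P₁ P₂ P₃ D D₂ D₃ Z B B₂ B₃ T₃ : ExteriorAlgebra ℤ M)
    (hΛ : Λ = Algebra.adjoin ℤ (Set.range fun p : M × M => ι ℤ p.1 * ι ℤ p.2))
    (hh₀ : h₀ = ι ℤ (x 0) * ι ℤ (x 1)) (hh₁ : h₁ = ι ℤ (x 2) * ι ℤ (x 3)) (hh₂ : h₂ = ι ℤ (x 4) * ι ℤ (x 5))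
    (hh₃ : h₃ = ι ℤ (x 6) * ι ℤ (x 7)) (hh₄ : h₄ = ι ℤ (x 8) * ι ℤ (x 9)) (hh₅ : h₅ = ι ℤ (x 10) * ι ℤ (x 11))
    (ms : s ∈ Λ) (mt : t ∈ Λ) (mu : u ∈ Λ)
    (hP₁ : P₁ = h₀ + h₁ + h₂ + h₃ + h₄)
    (hP₂ : P₂ = h₀ * h₁ + h₀ * h₂ + h₀ * h₃ + h₀ * h₄ + h₁ * h₂ + h₁ * h₃ + h₁ * h₄ + h₂ * h₃ + h₂ * h₄ + h₃ * h₄)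
    (hP₃ : P₃ = h₀ * h₁ * h₂ + h₀ * h₁ * h₃ + h₀ * h₁ * h₄ + h₀ * h₂ * h₃ + h₀ * h₂ * h₄ + h₀ * h₃ * h₄ + h₁ * h₂ * h₃ +
      h₁ * h₂ * h₄ + h₁ * h₃ * h₄ + h₂ * h₃ * h₄)
    (hD : D = 2 * P₁ + 4 * h₅)
    (hD₂ : D₂ = (8) * P₁ * h₅ + (4) * P₂)
    (hD₃ : D₃ = (16) * P₂ * h₅ + (8) * P₃)
    (mZspan : Z ∈ Submodule.span ℤ (Set.range fun p : M × M => ι ℤ p.1 * ι ℤ p.2))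
    (hB : B = P₁ + 2 * Z) (qB : B * B = 2 * B₂) (cB : B * B * B = 6 * B₃)
    (hσ₁ : σ₁ = 0) (hσ₂ : σ₂ = 4 * t - σ₀) (hσ₀ : σ₀ = 2 * s + 1) (hσ₃ : σ₃ = 4 * u)
    (hT₃ : T₃ = σ₃ * D₃ - 2 * σ₂ * (D₂ * B) + 4 * σ₁ * (D * B₂) - 8 * σ₀ * B₃) :
    ∀ Z' : ExteriorAlgebra ℤ M, T₃ ≠ 32 * Z' := by
  intro Z' hZ'
  have span_le : Submodule.span ℤ (Set.range fun p : M × M => ι ℤ p.1 * ι ℤ p.2) ≤ Subalgebra.toSubmodule Λ := by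
    rw [hΛ]; exact Algebra.span_le_adjoin ℤ _
  have mZ : Z ∈ Λ := span_le mZspan
  obtain ⟨Z₂, mZ₂', Z₃, mZ₃', qZ, cZ⟩ := exists_dividedPowers_of_mem_span Z mZspan
  have mZ₂ : Z₂ ∈ Λ := hΛ ▸ mZ₂'
  have mZ₃ : Z₃ ∈ Λ := hΛ ▸ mZ₃'
  obtain ⟨k₂, k₃⟩ := closedForms_clique5 x Λ h₀ h₁ h₂ h₃ h₄ P₁ P₂ P₃ Z Z₂ Z₃ B hΛ hh₀ hh₁ hh₂ hh₃ hh₄ mZ mZ₂ mZ₃ hP₁ hP₂ hP₃ qZ cZ hB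
  have hB₂c := cancel_two x (qB.symm.trans k₂)
  have hB₃c := cancel_six x (cB.symm.trans k₃)
  exact reading_Km11112 x Λ h₀ h₁ h₂ h₃ h₄ h₅ σ₀ σ₁ σ₂ σ₃ s t u P₁ P₂ P₃ D D₂ D₃ Z Z₂ Z₃ B₂ B₃ T₃ hΛ hh₀ hh₁ hh₂ hh₃
    hh₄ hh₅ ms mt mu mZ mZ₂ mZ₃ hP₁ hP₂ hP₃ hD hD₂ hD₃ hB₂c hB₃c (by rw [hT₃, hB]) hσ₁ hσ₂ hσ₀ hσ₃ Z' hZ'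

/-- **Clique unit of type (1,1,1,1,1,1) (clique = slots `0 … 5`): CLASS-DEAD as one theorem.**  `M` free with basis
`x : Fin 12`; the clique leading digit `P₁` with its closed forms `P₂, P₃`; the type `D` with the registered `D₂, D₃` and the
σ-parametrisation of the reading `reading_Km111111` (`q = 2`, modulus `2⁵`); ANY `Z` in the span of the 2-vectors (every integral 2-form) and the
class 2-form `B = P₁ + 2Z` with ANY `B₂, B₃` such that `B·B = 2B₂`, `B·B·B = 6B₃`; the registered `T₃(B)`.  THEN
`T₃(B) ≠ 32·Z′` for every `Z′`: the reading with NO closed-form GIVEN (`closedForms_clique6` + ROW H + cancellation). -/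
theorem classDead_Km111111 (x : Module.Basis (Fin 12) ℤ M) (Λ : Subalgebra ℤ (ExteriorAlgebra ℤ M))
    (h₀ h₁ h₂ h₃ h₄ h₅ σ₀ σ₁ σ₂ σ₃ s t u P₁ P₂ P₃ D D₂ D₃ Z B B₂ B₃ T₃ : ExteriorAlgebra ℤ M)
    (hΛ : Λ = Algebra.adjoin ℤ (Set.range fun p : M × M => ι ℤ p.1 * ι ℤ p.2))
    (hh₀ : h₀ = ι ℤ (x 0) * ι ℤ (x 1)) (hh₁ : h₁ = ι ℤ (x 2) * ι ℤ (x 3)) (hh₂ : h₂ = ι ℤ (x 4) * ι ℤ (x 5))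
    (hh₃ : h₃ = ι ℤ (x 6) * ι ℤ (x 7)) (hh₄ : h₄ = ι ℤ (x 8) * ι ℤ (x 9)) (hh₅ : h₅ = ι ℤ (x 10) * ι ℤ (x 11))
    (ms : s ∈ Λ) (mt : t ∈ Λ) (mu : u ∈ Λ)
    (hP₁ : P₁ = h₀ + h₁ + h₂ + h₃ + h₄ + h₅)
    (hP₂ : P₂ = h₀ * h₁ + h₀ * h₂ + h₀ * h₃ + h₀ * h₄ + h₀ * h₅ + h₁ * h₂ + h₁ * h₃ + h₁ * h₄ + h₁ * h₅ + h₂ * h₃ + h₂ *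
      h₄ + h₂ * h₅ + h₃ * h₄ + h₃ * h₅ + h₄ * h₅)
    (hP₃ : P₃ = h₀ * h₁ * h₂ + h₀ * h₁ * h₃ + h₀ * h₁ * h₄ + h₀ * h₁ * h₅ + h₀ * h₂ * h₃ + h₀ * h₂ * h₄ + h₀ * h₂ * h₅ +
      h₀ * h₃ * h₄ + h₀ * h₃ * h₅ + h₀ * h₄ * h₅ + h₁ * h₂ * h₃ + h₁ * h₂ * h₄ + h₁ * h₂ * h₅ + h₁ * h₃
      * h₄ + h₁ * h₃ * h₅ + h₁ * h₄ * h₅ + h₂ * h₃ * h₄ + h₂ * h₃ * h₅ + h₂ * h₄ * h₅ + h₃ * h₄ * h₅)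
    (hD : D = 2 * P₁)
    (hD₂ : D₂ = (4) * P₂)
    (hD₃ : D₃ = (8) * P₃)
    (mZspan : Z ∈ Submodule.span ℤ (Set.range fun p : M × M => ι ℤ p.1 * ι ℤ p.2))
    (hB : B = P₁ + 2 * Z) (qB : B * B = 2 * B₂) (cB : B * B * B = 6 * B₃)
    (hσ₁ : σ₁ = 0) (hσ₂ : σ₂ = 4 * t - σ₀) (hσ₀ : σ₀ = 2 * s + 1) (hσ₃ : σ₃ = 4 * u)
    (hT₃ : T₃ = σ₃ * D₃ - 2 * σ₂ * (D₂ * B) + 4 * σ₁ * (D * B₂) - 8 * σ₀ * B₃) :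
    ∀ Z' : ExteriorAlgebra ℤ M, T₃ ≠ 32 * Z' := by
  intro Z' hZ'
  have span_le : Submodule.span ℤ (Set.range fun p : M × M => ι ℤ p.1 * ι ℤ p.2) ≤ Subalgebra.toSubmodule Λ := by
    rw [hΛ]; exact Algebra.span_le_adjoin ℤ _
  have mZ : Z ∈ Λ := span_le mZspan
  obtain ⟨Z₂, mZ₂', Z₃, mZ₃', qZ, cZ⟩ := exists_dividedPowers_of_mem_span Z mZspan
  have mZ₂ : Z₂ ∈ Λ := hΛ ▸ mZ₂'
  have mZ₃ : Z₃ ∈ Λ := hΛ ▸ mZ₃'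
  obtain ⟨k₂, k₃⟩ := closedForms_clique6 x Λ h₀ h₁ h₂ h₃ h₄ h₅ P₁ P₂ P₃ Z Z₂ Z₃ B hΛ hh₀ hh₁ hh₂ hh₃ hh₄ hh₅ mZ mZ₂ mZ₃ hP₁ hP₂ hP₃ qZ cZ hB
  have hB₂c := cancel_two x (qB.symm.trans k₂)
  have hB₃c := cancel_six x (cB.symm.trans k₃)
  exact reading_Km111111 x Λ h₀ h₁ h₂ h₃ h₄ h₅ σ₀ σ₁ σ₂ σ₃ s t u P₁ P₂ P₃ D D₂ D₃ Z Z₂ Z₃ B₂ B₃ T₃ hΛ hh₀ hh₁ hh₂ hh₃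
    hh₄ hh₅ ms mt mu mZ mZ₂ mZ₃ hP₁ hP₂ hP₃ hD hD₂ hD₃ hB₂c hB₃c (by rw [hT₃, hB]) hσ₁ hσ₂ hσ₀ hσ₃ Z' hZ'

end Summit.Ventures.HSemireg.CliqueUnitsClassDead
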